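import Summits.QuantumFields.YangMills.Theorems.LuscherReductionTwistedTraceScalingBOStiffHSTLow
import Summits.QuantumFields.YangMills.Theorems.FlatTubeReductionStiffKCore
import Summits.QuantumFields.YangMills.Theorems.FlatTubeReductionStiffKQuasimode
import Summits.QuantumFields.YangMills.Theorems.FlatTubeReductionStiffKTails
import Summits.QuantumFields.YangMills.Theorems.FlatTubeReductionGaussProfileDefs
import HarnessLib


/-!
# (B-ST) K-port, part 10: ★★★ `hST_record_low_K` — the (B-ST) brick of record at a GENERAL CAP CONSTANT `K ≥ 2`, every tube exponent `0 < s ≤ 1/3`, UNCONDITIONAL;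
# and ★★★ `stub_hST_A` of crux K1 BY NAME
# (route `FlatTubeReduction`, crux K1 `NearFlatRatioLaw` stmt-QuantumFields-24720, line `ratepack_v2`, stub `stub_hST_A`; seat `ym-line-ftr-p1` g20; R2b1 RECORD rung — no summit statement is proved here)

Lane A's ✓`…BOStiffHSTLow.hST_record_of_specs_low` / ✓`hST_record_low` VERBATIM with the cap constant `43` of `recordChi L s 43 M β` replaced by a parameter `K ≥ 2` (the far
tail's `√2·β^{-1} ≤ (Kβ^{-s})³` wants `2 ≤ K³`; every other piece `K ≥ 1`), assembled from the K-ported pieces ✓`…FlatTubeReductionStiffK{WeightTransport,FibreTail,CoreCoeff,Tails,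
Currency,Central,Quasimode,Flat,Core}` by lane A's K-generic ✓`…BOStiffAssembly.hST_of_pieces`:
* ★★★ `hST_record_of_specs_low_K`, ★★★ `hST_record_low_K (hK : 2 ≤ K) (hLz) (hL2) (hs : 0 < s) (hs3 : s ≤ 1/3) : ∃ M₀ ≥ 2, ∀ M ≥ M₀, ∃ θ₀ ∈ (0,1], ∀ᶠ β, HST_K(β, θ₀, M)`;
* ★★★ `stub_hST_A` — VERBATIM the registered stub of skeleton «ratepack_v2» (v8) of crux K1: `hST_record_low_K` at `(s, K) = (1/6, 42·max 1 (|Site 3 L|/7) + 1)` for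
  `Ω_c = recordProfile L` (definitionally lane A's inline profile).
HONEST FRAMING: text port (slot substitution `43 ↦ K`) of lane A's fixed-`L` brick (constants visibly `L`-dependent, `θ₀ = θ₀(L,M)`), eventually in `β`, for a stub of the crux K1 of the
CONDITIONAL route R2b1 (RECORD rung); closes the registered stub `stub_hST_A`; the crux itself closes with the skeleton; not infinite volume, not a mass gap, not Clay.
-/

set_option autoImplicit false

noncomputable section

open MeasureTheory Filter Topology Real
open scoped BigOperators
open Literature.MathematicalPhysics.QuantumFieldTheory
open Literature.MathematicalPhysics.QuantumLattice

namespace Summit.QuantumFields.YangMills.Theorems.FemtoTransferGap.TwoLattice.ConstTube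

open Summit.QuantumFields.YangMills.Theorems.FemtoTransferGap
open Summit.QuantumFields.YangMills.Theorems.FemtoTransferGap.TwoLattice
open Summit.QuantumFields.YangMills.Theorems.FemtoTransferGap.TwoLattice.Avg
open Summit.QuantumFields.YangMills.Theorems.FemtoTransferGap.TwoLattice.Stiff
open Summit.QuantumFields.YangMills.Theorems.FemtoTransferGap.TwoLattice.GnChart
open Summit.QuantumFields.YangMills.Theorems.FemtoTransferGap.TwoLattice.Cov
open Summit.QuantumFields.YangMills.Theorems.FemtoTransferGap.TwoLattice.Toron
open Summit.QuantumFields.YangMills.Theorems.TwistedTraceScaling.Negative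

variable {L : ℕ} [NeZero L]

/-! ## §1 `hST` of record from the two specs at cap constant `K` -/

set_option maxHeartbeats 3200000 in
-- the full record assembly.
/-- ★★★ **`hST` OF RECORD FROM THE TWO FIBRE-BLOCK SPECS, every exponent `0 < s ≤ 1/3`** (see the module docstring). [cite: Luscher1983, §3] [cite: SeilerLNP1982, §3] -/
theorem hST_record_of_specs_low_K {K : ℝ} (hK : 2 ≤ K) (hLz : Nonempty (NzSite L)) (hL2 : 2 ≤ L) {s : ℝ} (hs : 0 < s) (hs3 : s ≤ 1 / 3)
    (hS3 : ∃ M₀ : ℝ, 2 ≤ M₀ ∧ ∀ M : ℝ, M₀ ≤ M → ∀ η : ℝ, 0 < η → ∀ η₂ : ℝ, 0 < η₂ → ∀ᶠ β : ℝ in atTop,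
      (∀ x ∈ cS L β, ∫ y, cM L β x y * cΘ L β y ∂orthoTransverse L ≤ (1 + η) * cΛK L s K M β * (cΘ L β x * cWK L s K M β x)) ∧
      (∫ x in cS L β, ((∫ y, cM L β x y * cΘ L β y ∂orthoTransverse L) - cΛK L s K M β * (cΘ L β x * cWK L s K M β x)) ^ 2 / cWK L s K M β x ∂orthoTransverse L ≤
        (η₂ * cΛK L s K M β) ^ 2 * ∫ x, cΘ L β x ^ 2 * cWK L s K M β x ∂orthoTransverse L))
    (hGI : ∃ M₀ : ℝ, 2 ≤ M₀ ∧ ∀ M : ℝ, M₀ ≤ M → ∃ P₀ Cν C'ν cJ : ℝ, 0 < P₀ ∧ 0 < Cν ∧ 0 < C'ν ∧ 0 < cJ ∧ cJ / (Cν * P₀) ≤ 1 ∧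
      ∀ δ : ℝ, 0 < δ → ∀ᶠ β : ℝ in atTop, ∃ (D : (Edge 3 L → Fin 3 → ℝ) → ℝ) (J₀ : (Edge 3 L → Fin 3 → ℝ) → (Edge 3 L → Fin 3 → ℝ) → ℝ) (θ₀ CD CJ : ℝ),
        Measurable D ∧ (∀ x, |D x| ≤ CD) ∧ Measurable (Function.uncurry J₀) ∧ (∀ x y, |J₀ x y| ≤ CJ) ∧ 0 < θ₀ ∧ (∀ x ∈ cS L β, θ₀ ≤ cΘ L β x) ∧
        0 < ∫ x in cS L β, D x ∂orthoTransverse L ∧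
        (∀ x ∈ cS L β, cΘ L β x ^ 2 * cWK L s K M β x ≤ Cν * D x) ∧ (∀ x ∈ cS L β, D x ≤ C'ν * (cΘ L β x ^ 2 * cWK L s K M β x)) ∧
        (∀ x y, cJ * (cΛK L s K M β * J₀ x y) ≤ cΘ L β x * cM L β x y * cΘ L β y) ∧
        (∀ g : (Edge 3 L → Fin 3 → ℝ) → ℝ, Measurable g → (∃ C : ℝ, ∀ x, |g x| ≤ C) → (∀ x, x ∉ cS L β → g x = 0) →
          (∫ x in cS L β, g x ^ 2 * D x ∂orthoTransverse L) - (∫ x in cS L β, g x * D x ∂orthoTransverse L) ^ 2 / (∫ x in cS L β, D x ∂orthoTransverse L) ≤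
            P₀ * ((1 / 2) * ∫ x, ∫ y, (g x - g y) ^ 2 * J₀ x y ∂orthoTransverse L ∂orthoTransverse L) + δ * ∫ x in cS L β, g x ^ 2 * D x ∂orthoTransverse L)) :
    ∃ M₀ : ℝ, 2 ≤ M₀ ∧ ∀ M : ℝ, M₀ ≤ M → ∃ θ₀ : ℝ, (0 < θ₀ ∧ θ₀ ≤ 1) ∧
      ∀ᶠ β : ℝ in atTop, ∀ v : GaugeConfig 3 L SU2 → ℝ, Measurable v → (∃ C : ℝ, ∀ U, |v U| ≤ C) → (∀ U, v U ≠ 0 → (recordChi L s K M β) U ≠ 0) → (∀ u, fibreInner L (softWeight (recordChi L s K M β)) (fun x : LinkSpace L => {x : LinkSpace L | linkCurry x ∈ capBalancedSet L}.indicator (fun _ => (1 : ℝ)) x * frozenProfile L (fun β' => stiffGaussExp L (β' / 2) β') (fun β' => min (1 / 40) (powScale (1 / 2) β' * btLog β')) β x) v u = 0) → tubeForm β v ≤ (1 - θ₀) * ((btC L β (fun x : LinkSpace L => {x : LinkSpace L | linkCurry x ∈ capBalancedSet L}.indicator (fun _ => (1 : ℝ)) x * frozenProfile L (fun β' => stiffGaussExp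 L (β' / 2) β') (fun β' => min (1 / 40) (powScale (1 / 2) β' * btLog β')) β x) (btEps β) (5 * (powScale (1 / 2) β * btLog β ^ 2)) / fpZ (btEps β) / recordGamma L (fun β' => fun x : LinkSpace L => {x : LinkSpace L | linkCurry x ∈ capBalancedSet L}.indicator (fun _ => (1 : ℝ)) x * frozenProfile L (fun β'' => stiffGaussExp L (β'' / 2) β'') (fun β'' => min (1 / 40) (powScale (1 / 2) β'' * btLog β'')) β' x) β) * levelValue su2Rep 1 ((L : ℝ) ^ 3 * β) 0) * tubeNormSq (softWeight (recordChi L s K M β)) v := by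
  have hK1 : 1 ≤ K := by linarith
  obtain ⟨Mc, hMc, Hc⟩ := hcore_record_of_specs_low_K (L := L) hK1 hLz hL2 hs hs3 hS3 hGI
  obtain ⟨Mf, hMf, Hf⟩ := hfar_record_K (L := L) hK hLz hs hs3
  obtain ⟨cΛf, Kf, hcΛf, hfloorΛ⟩ := recordLambda_floor (L := L)
  refine ⟨max Mc Mf, le_trans hMc (le_max_left _ _), fun M hM => ?_⟩
  have hMc' : Mc ≤ M := le_trans (le_max_left _ _) hM
  have hMf' : Mf ≤ M := le_trans (le_max_right _ _) hM
  have hM0 : 0 ≤ M := le_trans (by norm_num) (hMc.trans hMc')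
  obtain ⟨θ₀, hθ₀, hθ₀1, Hcβ⟩ := Hc M hMc'
  refine ⟨θ₀, ⟨hθ₀, by linarith⟩, ?_⟩
  have hε : 0 < θ₀ ^ 2 / 16 := by positivity
  filter_upwards [Hcβ, Hf M hMf' (θ₀ ^ 2 / 16) hε, hshell_record_K (L := L) hK1 hL2 hs hM0 hε, eventually_ge_atTop (0 : ℝ), hfloorΛ] with β hc hf hsh hβ0 hΛfl
    v hv hC hsupp hadm
  obtain ⟨-, -, hw0, -⟩ := softWeight_recordChi_props (L := L) s K M β
  have hΛ0 : 0 ≤ (btC L β (fun x : LinkSpace L => {x : LinkSpace L | linkCurry x ∈ capBalancedSet L}.indicator (fun _ => (1 : ℝ)) x * frozenProfile L (fun β' => stiffGaussExp L (β' / 2) β') (fun β' => min (1 / 40) (powScale (1 / 2) β' * btLog β')) β x) (btEps β) (5 * (powScale (1 / 2) β * btLog β ^ 2)) / fpZ (btEps β) / recordGamma L (fun β' => fun x : LinkSpace L => {x : LinkSpace L | linkCurry x ∈ capBalancedSet L}.indicator (fun _ => (1 : ℝ)) x * frozenProfile L (fun β'' => stiffGaussExp L (β'' / 2) β'') (fun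 β'' => min (1 / 40) (powScale (1 / 2) β'' * btLog β'')) β' x) β *
            levelValue su2Rep 1 ((L : ℝ) ^ 3 * β) 0) :=
    le_trans (mul_nonneg (mul_nonneg hcΛf.le (pow_nonneg (powScale_pos 1 β).le _)) (pow_nonneg (Real.exp_pos _).le _)) hΛfl
  have hS₂ : MeasurableSet {U : GaugeConfig 3 L SU2 | powScale 1 β * btLog β < ‖(gaugeModes L).starProjection (relLinkVec L U)‖} := measurableSet_far_record (L := L) _
  have hS₃ : MeasurableSet {U : GaugeConfig 3 L SU2 | min (1 / 40) (powScale (1 / 2) β * btLog β) / 2 < ‖relLinkVec L U‖} := measurableSet_shell_record (L := L) _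
  have habc := pieces_budget (Λ := (btC L β (fun x : LinkSpace L => {x : LinkSpace L | linkCurry x ∈ capBalancedSet L}.indicator (fun _ => (1 : ℝ)) x * frozenProfile L (fun β' => stiffGaussExp L (β' / 2) β') (fun β' => min (1 / 40) (powScale (1 / 2) β' * btLog β')) β x) (btEps β) (5 * (powScale (1 / 2) β * btLog β ^ 2)) / fpZ (btEps β) / recordGamma L (fun β' => fun x : LinkSpace L => {x : LinkSpace L | linkCurry x ∈ capBalancedSet L}.indicator (fun _ => (1 : ℝ)) x * frozenProfile L (fun β'' => stiffGaussExp L (β'' / 2) β'') (fun β'' => min (1 / 40) (powScale (1 / 2) β'' * btLog β'')) β' x) β *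
            levelValue su2Rep 1 ((L : ℝ) ^ 3 * β) 0))
    hΛ0 hθ₀ (by linarith) hε.le (by nlinarith) (le_refl ((1 - 4 * θ₀) * _)) (le_refl (θ₀ ^ 2 / 16 * _)) (le_refl (θ₀ ^ 2 / 16 * _))
  have ha₁ : 0 ≤ (1 - 4 * θ₀) * (btC L β (fun x : LinkSpace L => {x : LinkSpace L | linkCurry x ∈ capBalancedSet L}.indicator (fun _ => (1 : ℝ)) x * frozenProfile L (fun β' => stiffGaussExp L (β' / 2) β') (fun β' => min (1 / 40) (powScale (1 / 2) β' * btLog β')) β x) (btEps β) (5 * (powScale (1 / 2) β * btLog β ^ 2)) / fpZ (btEps β) / recordGamma L (fun β' => fun x : LinkSpace L => {x : LinkSpace L | linkCurry x ∈ capBalancedSet L}.indicator (fun _ => (1 : ℝ)) x * frozenProfile L (fun β'' => stiffGaussExp L (β'' / 2) β'') (fun β'' => min (1 / 40) (powScale (1 / 2) β'' * btLog β'')) β' x) β *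
            levelValue su2Rep 1 ((L : ℝ) ^ 3 * β) 0) := mul_nonneg (by linarith) hΛ0
  have ha₂ : 0 ≤ θ₀ ^ 2 / 16 * (btC L β (fun x : LinkSpace L => {x : LinkSpace L | linkCurry x ∈ capBalancedSet L}.indicator (fun _ => (1 : ℝ)) x * frozenProfile L (fun β' => stiffGaussExp L (β' / 2) β') (fun β' => min (1 / 40) (powScale (1 / 2) β' * btLog β')) β x) (btEps β) (5 * (powScale (1 / 2) β * btLog β ^ 2)) / fpZ (btEps β) / recordGamma L (fun β' => fun x : LinkSpace L => {x : LinkSpace L | linkCurry x ∈ capBalancedSet L}.indicator (fun _ => (1 : ℝ)) x * frozenProfile L (fun β'' => stiffGaussExp L (β'' / 2) β'') (fun β'' => min (1 / 40) (powScale (1 / 2) β'' * btLog β'')) β' x) β *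
            levelValue su2Rep 1 ((L : ℝ) ^ 3 * β) 0) := mul_nonneg hε.le hΛ0
  set Adm : (GaugeConfig 3 L SU2 → ℝ) → Prop := fun v => ∀ u : GaugeConfig 3 1 SU2, fibreInner L (softWeight (recordChi L s K M β)) (fun x : LinkSpace L => {x : LinkSpace L | linkCurry x ∈ capBalancedSet L}.indicator (fun _ => (1 : ℝ)) x *
          frozenProfile L (fun β' => stiffGaussExp L (β' / 2) β') (fun β' => min (1 / 40) (powScale (1 / 2) β' * btLog β')) β x) v u = 0
    with hAdm
  have hadm' : Adm v := hadm
  exact hST_of_pieces (L := L) hβ0 hw0 Adm hS₂ hS₃ ha₁ ha₂ ha₂ habc (fun v hv hC hsupp hadm => hc v hv hC hsupp hadm) (fun v hv hC hsupp hadm => hf Adm v hv hC hsupp hadm)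
    (fun v hv hC hsupp hadm => hsh Adm v hv hC hsupp hadm) v hv hC hsupp hadm'

/-! ## §2 ★★★ The (B-ST) brick of record at cap constant `K ≥ 2`, unconditionally -/

set_option maxHeartbeats 1600000 in
-- the full record assembly.
/-- ★★★ **THE (B-ST) BRICK OF RECORD FOR EVERY TUBE EXPONENT `0 < s ≤ 1/3`, UNCONDITIONAL**: `∃ M₀ ≥ 2, ∀ M ≥ M₀, ∃ θ₀ ∈ (0,1], ∀ᶠ β, HST(β, θ₀, M)` —
`hST_record_of_specs_low_K` fed with ✓`spec_S3_low_K` and `spec_gap_inputs_of_hflat_low_K ∘` ✓`hflat_record_K`. [cite: Luscher1983, §3] [cite: SjostrandZworski2007, §2] -/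
theorem hST_record_low_K {K : ℝ} (hK : 2 ≤ K) (hLz : Nonempty (NzSite L)) (hL2 : 2 ≤ L) {s : ℝ} (hs : 0 < s) (hs3 : s ≤ 1 / 3) :
    ∃ M₀ : ℝ, 2 ≤ M₀ ∧ ∀ M : ℝ, M₀ ≤ M → ∃ θ₀ : ℝ, (0 < θ₀ ∧ θ₀ ≤ 1) ∧
      ∀ᶠ β : ℝ in atTop, ∀ v : GaugeConfig 3 L SU2 → ℝ, Measurable v → (∃ C : ℝ, ∀ U, |v U| ≤ C) → (∀ U, v U ≠ 0 → (recordChi L s K M β) U ≠ 0) → (∀ u, fibreInner L (softWeight (recordChi L s K M β)) (fun x : LinkSpace L => {x : LinkSpace L | linkCurry x ∈ capBalancedSet L}.indicator (fun _ => (1 : ℝ)) x * frozenProfile L (fun β' => stiffGaussExp L (β' / 2) β') (fun β' => min (1 / 40) (powScale (1 / 2) β' * btLog β')) β x) v u = 0) → tubeForm β v ≤ (1 - θ₀) * ((btC L β (fun x : LinkSpace L => {x : LinkSpace L | linkCurry x ∈ capBalancedSet L}.indicator (fun _ => (1 : ℝ)) x * frozenProfile L (fun β' => stiffGaussExp L (β'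 / 2) β') (fun β' => min (1 / 40) (powScale (1 / 2) β' * btLog β')) β x) (btEps β) (5 * (powScale (1 / 2) β * btLog β ^ 2)) / fpZ (btEps β) / recordGamma L (fun β' => fun x : LinkSpace L => {x : LinkSpace L | linkCurry x ∈ capBalancedSet L}.indicator (fun _ => (1 : ℝ)) x * frozenProfile L (fun β'' => stiffGaussExp L (β'' / 2) β'') (fun β'' => min (1 / 40) (powScale (1 / 2) β'' * btLog β'')) β' x) β) * levelValue su2Rep 1 ((L : ℝ) ^ 3 * β) 0) * tubeNormSq (softWeight (recordChi L s K M β)) v :=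
  hST_record_of_specs_low_K (L := L) hK hLz hL2 hs hs3 (spec_S3_low_K (L := L) (by linarith) hLz hL2 hs hs3)
    (spec_gap_inputs_of_hflat_low_K (L := L) (by linarith) hLz hL2 hs hs3 (hflat_record_K (L := L) (by linarith) hLz hL2 hs hs3))

/-! ## §3 ★★★ The registered stub `stub_hST_A` of crux K1 `NearFlatRatioLaw` (skeleton «ratepack_v2», v8) BY NAME -/

/-- ★★★ **`stub_hST_A` (crux K1 `NearFlatRatioLaw`, line «ratepack_v2»): THE STIFF GAP FOR THE UN-NORMALISED RECORD PROFILE AT THE RATE TWIN'S WINDOW** — for every `L ≥ 2` there is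
`M₁` such that for every `M ≥ M₁` there is a gap `θ_A ∈ (0,1]` with, eventually in `β`, every bounded measurable `v` supported in `{recordChi L (1/6) (42D_L+1) M β ≠ 0}`
(`D_L = max 1 (|Site 3 L|/7)`) and fibre-orthogonal to `recordProfile L β` has `tubeForm β v ≤ (1 − θ_A)·((btC/fpZ/recordGamma)·λ₀(1,L³β))·tubeNormSq (softWeight χ_β) v`:
`hST_record_low_K` at `s = 1/6`, `K = 42D_L + 1 ≥ 43` (`recordProfile L` is lane A's inline profile by `rfl`). [cite: Luscher1983, §3] [cite: SjostrandZworski2007, §2] -/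
theorem stub_hST_A :
    ∀ (L : ℕ) [NeZero L], 2 ≤ L → ∃ M₁ : ℝ, ∀ M : ℝ, M₁ ≤ M → ∃ θA : ℝ, 0 < θA ∧ θA ≤ 1 ∧
      ∀ᶠ β : ℝ in atTop, ∀ v : GaugeConfig 3 L SU2 → ℝ, Measurable v → (∃ C : ℝ, ∀ U, |v U| ≤ C) →
        (∀ U, v U ≠ 0 → recordChi L (1 / 6) (42 * max 1 ((Fintype.card (Site 3 L) : ℝ) / 7) + 1) M β U ≠ 0) →
        (∀ u, fibreInner L (softWeight (recordChi L (1 / 6) (42 * max 1 ((Fintype.card (Site 3 L) : ℝ) / 7) + 1) M β)) (recordProfile L β) v u = 0) →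
        tubeForm β v ≤ (1 - θA) * (btC L β (recordProfile L β) (btEps β) (5 * (powScale (1 / 2) β * btLog β ^ 2)) / fpZ (btEps β) / recordGamma L (recordProfile L) β *
            levelValue su2Rep 1 ((L : ℝ) ^ 3 * β) 0) *
          tubeNormSq (softWeight (recordChi L (1 / 6) (42 * max 1 ((Fintype.card (Site 3 L) : ℝ) / 7) + 1) M β)) v := by
  intro L _ hL
  have hK : (2 : ℝ) ≤ 42 * max 1 ((Fintype.card (Site 3 L) : ℝ) / 7) + 1 := by
    have := le_max_left (1 : ℝ) ((Fintype.card (Site 3 L) : ℝ) / 7); linarith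
  have hLz : Nonempty (NzSite L) := by
    haveI : Fact (1 < L) := ⟨hL⟩
    exact ⟨⟨fun _ => 1, fun h => one_ne_zero (congrFun h 0)⟩⟩
  obtain ⟨M₀, -, H⟩ := hST_record_low_K (L := L) hK hLz hL (s := 1 / 6) (by norm_num) (by norm_num)
  refine ⟨M₀, fun M hM => ?_⟩
  obtain ⟨θ₀, ⟨hθ₀, hθ₁⟩, hev⟩ := H M hM
  exact ⟨θ₀, hθ₀, hθ₁, hev⟩

end Summit.QuantumFields.YangMills.Theorems.FemtoTransferGap.TwoLattice.ConstTube

end
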